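import Summits.NavierStokesRegularity.NavierStokesRegularity.Theorems.ScaledTopAlignmentTypeIZoomNonAlignedLimitOseenSlab
import Summits.NavierStokesRegularity.NavierStokesRegularity.Theorems.SqueezeCycleSingularZoomExtraction
import Literature.Analysis.FluidPDE.NSLerayBlowupRateTopHolds
import Literature.Analysis.FluidPDE.DirectionDissipation
import HarnessLib

/-!
# Route `ScaledTopAlignment`, crux GAP″ = `TypeIZoomNonAlignedLimit` (stmt-NavierStokesRegularity-19902):
# the zoom step — a Type-I blow-up has a NON-TRIVIAL Type-I ancient mild zoom limit whose slice
# vorticities are pointwise limits of parabolic vorticity zooms with moving centres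

This is the compactness half ("Z", p3's `stub_zoomProfile` / `stub_zoomSlices`, GapSkeleton2.lean
attached to the item 2026-08-25T20:56Z) of the crux `TypeIZoomNonAlignedLimit`, proved over the
tree's Type-I ancient mild class `IsTypeIAncientMild C W` (KNSS/Oseen gauge) instead of p3's inline
`IsOseenTypeIProfile` (whose extra clause "`W` bounded on all of `(-∞,0) × ℝ³`" is not inherited by
Type-I zoom limits and is not used by the rigidity half):

* `typeIZoom_ancientMild_limit` — for `ν > 0`, `T > 0`, a classical solution `(u, p)` on `ℝ³ × [0,T)`,
  Leray–Hopf from `u 0`, bounded on every closed sub-strip, with the Type-I rate at `T`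
  (`IsTypeIBlowup u T`) and NO smooth extension past `T`, there are `C`, a field `W` with
  `IsTypeIAncientMild C W` and `W(−1, 0) ≠ 0`, and for every `s < 0` centres `x_j`, times
  `t_j ∈ [0, T)` and scales `λ_j → 0⁺` with
  `(λ_j²/ν) ω(t_j, x_j + λ_j y) → curl W(s) (y)` for every `y` (`ω = curl u`).

## Proof (KNSS 2009 §6 / Seregin–Šverák 2009 / Giga–Miura 2011 Prop. 2.1–2.2, with Leray's rate)

1. Leray's lower bound (tree theorem `leray_blowup_rate_top_holds`, Leray 1934 §19 (3.9)):
   `‖u(t)‖_∞ ≥ c₀√ν/√(T − t)` for every `t < T` since `u` is maximal; as `u(t)` is continuous there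
   are points `x_k` with `‖u(t_k, x_k)‖ ≥ c₀√ν/(2√(T − t_k))` at the times `t_k = T − c_k² T`,
   `c_k = 1/(k+2)`.
2. The global rate `√(T − t)‖u(t, x)‖ ≤ C₁` on `(0, T)` (Type I near `T`, slab bound before).
3. The viscosity-normalising zooms `w_k(s, y) = c_k α u(T + c_k² β s, x_k + c_k R y)`, `R = √(νT)`,
   `α = R/ν`, `β = R²/ν = T`, about the MOVING centres `(T, x_k)` are jointly continuous, weakly
   divergence free, Oseen-mild (`zoom_oseen_of_slab`) on the windows `(−1/c_k², 0)`, and obey the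
   common Type-I bound `(αC₁/√β)/√(−s)` (`zoom_norm_le`); `‖w_k(−1, 0)‖ ≥ c₀/2`.
4. `exists_tendsto_of_typeI_seq_Ioo` (KNSS 2009 Lemma 6.1 + Prop. 4.1, the tree's `C¹_loc`
   compactness on growing windows): along a subsequence `w_k → W`, `∇w_k → ∇W` pointwise on `t < 0`,
   `IsTypeIAncientMild C W`; hence `‖W(−1, 0)‖ ≥ c₀/2` and, since
   `curl w_k(s)(y) = ((c_k R)²/ν) ω(T + c_k²βs, x_k + c_k R y)` (`curl_smul_stPull`) and `curl` is a
   linear function of the gradient (`curlCLM`), the vorticity zooms converge to `curl W(s)`.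
-/

noncomputable section

-- the summit and its single sub-problem share the name (CONVENTIONS §1), as in every Theorems file
set_option linter.dupNamespace false

open MeasureTheory Set Function Filter TopologicalSpace Metric
open scoped Topology NNReal ENNReal InnerProductSpace RealInnerProductSpace

namespace Summit.NavierStokesRegularity.NavierStokesRegularity.Theorems

open Literature.Analysis Literature.Analysis.FluidPDE

section LerayPoints

variable {ν T : ℝ} {u : ℝ → EuclideanSpace ℝ (Fin 3) → EuclideanSpace ℝ (Fin 3)}
  {p : ℝ → EuclideanSpace ℝ (Fin 3) → ℝ}

/-- **Near-maximum points carry Leray's rate.** For a classical solution on `[0, T)` which is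
Leray–Hopf from `u 0`, bounded on every closed sub-strip and does not extend smoothly past `T`,
at every `t ∈ [0, T)` there is a point `x` with `‖u(t, x)‖ ≥ c₀√ν/√(T − t)/2`, where `c₀ > 0` is
Leray's universal constant (`leray_blowup_rate_top_holds`: `‖u(t)‖_∞ ≥ c₀√ν (T−t)^{-1/2}`; the
slice is continuous, so the essential supremum is approached by values). [cite: Leray1934, §19 (3.8)–(3.9) p. 224] -/
theorem exists_lerayRate_points (hν : 0 < ν) (hT : 0 < T)
    (hsol : IsClassicalNSSolutionOn (Ico 0 T) ν 0 u p) (hLH : IsLerayHopfOn T ν 0 (u 0) u)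
    (hbdd : ∀ T₁ ∈ Ioo 0 T, ∃ M : ℝ, ∀ t ∈ Icc 0 T₁, ∀ x, ‖u t x‖ ≤ M)
    (hext : ¬ HasSmoothExtensionPast ν 0 u T) :
    ∃ c₀ : ℝ, 0 < c₀ ∧ ∀ t ∈ Ico 0 T, ∃ x : EuclideanSpace ℝ (Fin 3),
      c₀ * Real.sqrt ν / Real.sqrt (T - t) / 2 ≤ ‖u t x‖ := by
  obtain ⟨c₀, hc₀, hLeray⟩ := leray_blowup_rate_top_holds
  refine ⟨c₀, hc₀, fun t ht => ?_⟩
  have hstrip : ∀ T' ∈ Ioo 0 T,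
      eLpNorm (uncurry u) ∞ (volume.restrict (Icc 0 T' ×ˢ univ)) < ∞ := by
    intro T' hT'
    obtain ⟨M, hM⟩ := hbdd T' hT'
    refine lt_of_le_of_lt ?_ (ENNReal.ofReal_lt_top (r := M))
    rw [eLpNorm_exponent_top]
    refine eLpNormEssSup_le_of_ae_bound ?_
    rw [ae_restrict_iff' (measurableSet_Icc.prod MeasurableSet.univ)]
    exact Eventually.of_forall fun z hz => hM z.1 (mem_prod.1 hz).1 z.2
  have hle := hLeray ν T hν hT u p ⟨hsol, hext⟩ hLH hstrip t ht
  by_contra hno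
  push Not at hno
  have hsq : 0 < Real.sqrt (T - t) := Real.sqrt_pos.2 (sub_pos.2 ht.2)
  have hpos : 0 < c₀ * Real.sqrt ν / Real.sqrt (T - t) := by positivity
  have hbd : eLpNorm (u t) ∞ volume ≤ ENNReal.ofReal (c₀ * Real.sqrt ν / Real.sqrt (T - t) / 2) := by
    rw [eLpNorm_exponent_top]
    exact eLpNormEssSup_le_of_ae_bound (Eventually.of_forall fun x => (hno x).le)
  have hlt : ENNReal.ofReal (c₀ * Real.sqrt ν / Real.sqrt (T - t) / 2) <
      ENNReal.ofReal (c₀ * Real.sqrt ν / Real.sqrt (T - t)) := by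
    rw [ENNReal.ofReal_lt_ofReal_iff hpos]
    exact half_lt_self hpos
  exact absurd (hle.trans hbd) (not_le.2 hlt)

/-- **The global rate of a Type-I classical solution bounded on closed sub-strips**: if
`IsTypeIBlowup u T` and `u` is bounded on every `[0, T₁] × ℝ³`, `T₁ < T`, then
`√(T − t)‖u(t, x)‖ ≤ C₁` for all `0 < t < T` and some `C₁` (Type I near `T`, the slab bound before). [folklore] -/
theorem exists_global_typeI_rate (hT : 0 < T)
    (hbdd : ∀ T₁ ∈ Ioo 0 T, ∃ M : ℝ, ∀ t ∈ Icc 0 T₁, ∀ x, ‖u t x‖ ≤ M) (hI : IsTypeIBlowup u T) :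
    ∃ C₁ : ℝ, ∀ t ∈ Ioo (T - T) T, ∀ x, Real.sqrt (T - t) * ‖u t x‖ ≤ C₁ := by
  obtain ⟨CI, hCI⟩ := hI
  obtain ⟨l, hlT, hl⟩ := mem_nhdsLT_iff_exists_Ioo_subset.1 hCI
  set T₀ : ℝ := (max l 0 + T) / 2 with hT₀
  have hlT' : max l 0 < T := max_lt hlT hT
  have hT₀0 : 0 < T₀ := by rw [hT₀]; linarith [le_max_right l 0]
  have hT₀T : T₀ < T := by rw [hT₀]; linarith
  have hlT₀ : l < T₀ := by rw [hT₀]; linarith [le_max_left l 0]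
  obtain ⟨M₀, hM₀⟩ := hbdd T₀ ⟨hT₀0, hT₀T⟩
  refine ⟨max CI (Real.sqrt T * M₀), fun t ht x => ?_⟩
  rw [sub_self] at ht
  rcases le_or_gt t T₀ with htl | htg
  · refine le_trans ?_ (le_max_right _ _)
    exact mul_le_mul (Real.sqrt_le_sqrt (by linarith [ht.1])) (hM₀ t ⟨ht.1.le, htl⟩ x)
      (norm_nonneg _) (Real.sqrt_nonneg _)
  · refine le_trans ?_ (le_max_left _ _)
    have hsq : 0 < Real.sqrt (T - t) := Real.sqrt_pos.2 (sub_pos.2 ht.2)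
    have h := hl ⟨hlT₀.trans htg, ht.2⟩ x
    rwa [le_div_iff₀ hsq, mul_comm] at h

end LerayPoints

section Zoom

variable {ν T : ℝ} {u : ℝ → EuclideanSpace ℝ (Fin 3) → EuclideanSpace ℝ (Fin 3)}
  {p : ℝ → EuclideanSpace ℝ (Fin 3) → ℝ}

/-- **The Type-I zoom limit with moving centres (Z).** For `ν > 0`, `T > 0`, a classical solution
`(u, p)` on `ℝ³ × [0, T)`, Leray–Hopf from `u 0`, bounded on every closed sub-strip `[0, T'] × ℝ³`,
`T' < T`, with the Type-I rate at `T` and no smooth extension past `T`: there are `C` and a Type-I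
ancient mild field `W` (`IsTypeIAncientMild C W`: jointly smooth on `t < 0`, divergence free,
Oseen-mild between all `s < t < 0`, `‖W(t)‖ ≤ C/√(−t)`) with `W(−1, 0) ≠ 0`, such that every slice
vorticity `curl W(s)`, `s < 0`, is the pointwise limit of parabolic vorticity zooms
`(λ_j²/ν) ω(t_j, x_j + λ_j ·)` of `u` with `t_j ∈ [0, T)`, `λ_j → 0⁺` (moving centres `x_j` =
Leray near-maximum points; KNSS 2009 §6 rescaling + Lemma 6.1 / Prop. 4.1 compactness in the tree's
form `exists_tendsto_of_typeI_seq_Ioo`; Giga–Miura 2011, Prop. 2.1–2.2; non-triviality from Leray's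
rate `‖u(t)‖_∞ ≥ c₀√ν/√(T−t)`). [cite: KochNadirashviliSereginSverak2009, §6 Lemma 6.1 and proof of Thm 6.2 (arXiv:0709.3599 pp. 11–13)] -/
theorem typeIZoom_ancientMild_limit (hν : 0 < ν) (hT : 0 < T)
    (hsol : IsClassicalNSSolutionOn (Ico 0 T) ν 0 u p) (hLH : IsLerayHopfOn T ν 0 (u 0) u)
    (hslab : ∀ T' < T, ∃ M : ℝ, ∀ t ∈ Icc 0 T', ∀ x, ‖u t x‖ ≤ M)
    (hI : IsTypeIBlowup u T) (hext : ¬ HasSmoothExtensionPast ν 0 u T) :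
    ∃ (C : ℝ) (W : ℝ → EuclideanSpace ℝ (Fin 3) → EuclideanSpace ℝ (Fin 3)),
      IsTypeIAncientMild C W ∧ W (-1) 0 ≠ 0 ∧
      ∀ s < (0 : ℝ), ∃ (xc : ℕ → EuclideanSpace ℝ (Fin 3)) (t : ℕ → ℝ) (lam : ℕ → ℝ),
        (∀ j, t j ∈ Ico 0 T) ∧ (∀ j, 0 < lam j) ∧ Tendsto lam atTop (𝓝 0) ∧
        ∀ y, Tendsto (fun j => (lam j ^ 2 / ν) • curl (u (t j)) (xc j + lam j • y)) atTop
          (𝓝 (curl (W s) y)) := by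
  have hbdd : ∀ T₁ ∈ Ioo 0 T, ∃ M : ℝ, ∀ t ∈ Icc 0 T₁, ∀ x, ‖u t x‖ ≤ M :=
    fun T₁ hT₁ => hslab T₁ hT₁.2
  -- Steps 1–2: Leray points and the global rate
  obtain ⟨c₀, hc₀, hlow⟩ := exists_lerayRate_points hν hT hsol hLH hbdd hext
  obtain ⟨C₁, hrate⟩ := exists_global_typeI_rate (u := u) hT hbdd hI
  -- Step 3: scales
  set R : ℝ := Real.sqrt (ν * T) with hRdef
  have hR : 0 < R := Real.sqrt_pos.2 (mul_pos hν hT)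
  set α : ℝ := R / ν with hα
  set β : ℝ := R ^ 2 / ν with hβ
  have hν0 : ν ≠ 0 := hν.ne'
  have hβT : β = T := by
    rw [hβ, hRdef, Real.sq_sqrt (mul_pos hν hT).le]; field_simp
  have hβpos : 0 < β := by rw [hβT]; exact hT
  set c : ℕ → ℝ := fun k => 1 / ((k : ℝ) + 2) with hcdef
  have hc : ∀ k, 0 < c k := fun k => by rw [hcdef]; positivity
  have hc1 : ∀ k, c k < 1 := fun k => by
    rw [hcdef, div_lt_one (by positivity)]; linarith [(Nat.cast_nonneg k : (0 : ℝ) ≤ k)]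
  have hc0 : Tendsto c atTop (𝓝 0) := by
    have h := (tendsto_one_div_add_atTop_nhds_zero_nat (𝕜 := ℝ)).comp (tendsto_add_atTop_nat 1)
    refine h.congr fun k => ?_
    simp only [hcdef, comp_apply, Nat.cast_add, Nat.cast_one]
    ring
  -- the windows `(A k, 0)`, `A k = -(T/(c_k² β)) = -(k+2)²`
  set A : ℕ → ℝ := fun k => -(T / (c k ^ 2 * β)) with hAdef
  have hAk : ∀ k, A k = -(((k : ℝ) + 2) ^ 2) := fun k => by
    simp only [hAdef, hcdef, hβT]
    field_simp
  have hA : Tendsto A atTop atBot := by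
    have h1 : Tendsto (fun k : ℕ => ((k : ℝ) + 2) ^ 2) atTop atTop := by
      refine tendsto_atTop_mono (fun k => ?_)
        (tendsto_atTop_add_const_right _ 2 tendsto_natCast_atTop_atTop)
      nlinarith [(Nat.cast_nonneg k : (0 : ℝ) ≤ k)]
    exact (tendsto_neg_atTop_atBot.comp h1).congr fun k => (hAk k).symm
  -- `-1` lies in every window
  have hm1 : ∀ k, (-1 : ℝ) ∈ Ioo (-(T / (c k ^ 2 * β))) 0 := fun k => by
    refine ⟨?_, by norm_num⟩
    show A k < -1
    rw [hAk]
    nlinarith [(Nat.cast_nonneg k : (0 : ℝ) ≤ k)]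
  -- the near-maximum centres at the times `t_k = T - c_k² β`
  set tk : ℕ → ℝ := fun k => T + c k ^ 2 * β * (-1) with htkdef
  have htk : ∀ k, tk k ∈ Ico 0 T := fun k => (zoom_time_mem (T := T) (hc k) hβpos le_rfl (hm1 k)).2
  choose xk hxk using fun k => hlow (tk k) (htk k)
  -- the zooms
  set w : ℕ → ℝ → EuclideanSpace ℝ (Fin 3) → EuclideanSpace ℝ (Fin 3) :=
    fun k => (c k * α) • stPull (c k ^ 2 * β) (c k * R) T (xk k) u with hwdef
  have hcw : ∀ k, ContinuousOn (uncurry (w k)) (Ioo (A k) 0 ×ˢ univ) := fun k =>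
    zoom_continuousOn (x₀ := xk k) hν hsol hR hα hβ (hc k) le_rfl
  have hdivw : ∀ k, ∀ t ∈ Ioo (A k) 0, IsWeaklyDivFree (w k t) := fun k t ht =>
    zoom_isWeaklyDivFree (x₀ := xk k) hν hsol hR hα hβ (hc k) le_rfl ht
  have hmild : ∀ k, ∀ s t : ℝ, A k < s → s < t → t < 0 → ∀ x,
      w k t x = UnboundedOperators.heatExtension (w k s) (t - s) x -
        oseenDuhamel 1 s (w k) (w k) t x := fun k s t hs hst ht x =>
    zoom_oseen_of_slab (x₀ := xk k) hν hT hsol hLH hbdd hR hα hβ (hc k) le_rfl hs hst ht x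
  have hIw : ∀ k, ∀ t ∈ Ioo (A k) 0, ∀ x, ‖w k t x‖ ≤ (α * C₁ / Real.sqrt β) / Real.sqrt (-t) :=
    fun k t ht x => zoom_norm_le (T := T) (x₀ := xk k) (u := u) hR hα hβ hν (hc k) le_rfl hrate ht x
  -- Step 4: extraction
  obtain ⟨φ, hφ, W, hW, hpt, hptD, -, -⟩ :=
    exists_tendsto_of_typeI_seq_Ioo (α * C₁ / Real.sqrt β) hA hcw hdivw hmild hIw
  have hφt : Tendsto φ atTop atTop := hφ.tendsto_atTop
  -- Step 5: non-triviality at `(-1, 0)`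
  have hsqrt : ∀ k, Real.sqrt (T - tk k) = c k * Real.sqrt T := fun k => by
    have e : T - tk k = (c k) ^ 2 * T := by simp only [htkdef, hβT]; ring
    rw [e, Real.sqrt_mul (sq_nonneg _), Real.sqrt_sq (hc k).le]
  have hkey : ∀ k, c k * α * (c₀ * Real.sqrt ν / Real.sqrt (T - tk k) / 2) = c₀ / 2 := fun k => by
    rw [hsqrt k, hα, hRdef, Real.sqrt_mul hν.le]
    have hsν : Real.sqrt ν ≠ 0 := (Real.sqrt_pos.2 hν).ne'
    have hsT : Real.sqrt T ≠ 0 := (Real.sqrt_pos.2 hT).ne'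
    have hck : c k ≠ 0 := (hc k).ne'
    have e1 : Real.sqrt ν * Real.sqrt T / ν = Real.sqrt T / Real.sqrt ν := by
      rw [div_eq_div_iff hν0 hsν]
      calc Real.sqrt ν * Real.sqrt T * Real.sqrt ν
          = Real.sqrt T * (Real.sqrt ν * Real.sqrt ν) := by ring
        _ = Real.sqrt T * ν := by rw [Real.mul_self_sqrt hν.le]
    rw [e1]
    field_simp
  have hwk : ∀ k, c₀ / 2 ≤ ‖w k (-1) 0‖ := fun k => by
    have e : w k (-1) 0 = (c k * α) • u (tk k) (xk k) := by
      simp only [hwdef, smul_stPull_apply, smul_zero, add_zero, htkdef]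
    rw [e, norm_smul, Real.norm_of_nonneg (by positivity : (0 : ℝ) ≤ c k * α), ← hkey k]
    exact mul_le_mul_of_nonneg_left (hxk k) (by positivity)
  have hW0 : W (-1) 0 ≠ 0 := by
    have hlim : c₀ / 2 ≤ ‖W (-1) 0‖ :=
      ge_of_tendsto' ((hpt (-1) (by norm_num) 0).norm) fun j => hwk (φ j)
    intro h
    rw [h, norm_zero] at hlim
    linarith
  refine ⟨α * C₁ / Real.sqrt β, W, hW, hW0, fun s hs => ?_⟩
  -- Step 6: the slice `s < 0`
  have hAφ : Tendsto (fun j => A (φ j)) atTop atBot := hA.comp hφt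
  obtain ⟨j₀, hj₀⟩ : ∃ j₀ : ℕ, ∀ j, j₀ ≤ j → A (φ j) < s :=
    eventually_atTop.1 (hAφ.eventually (eventually_lt_atBot s))
  set k : ℕ → ℕ := fun j => φ (j + j₀) with hkdef
  have hks : ∀ j, s ∈ Ioo (-(T / (c (k j) ^ 2 * β))) 0 := fun j =>
    ⟨hj₀ (j + j₀) (Nat.le_add_left _ _), hs⟩
  refine ⟨fun j => xk (k j), fun j => T + c (k j) ^ 2 * β * s, fun j => c (k j) * R,
    fun j => (zoom_time_mem (T := T) (hc (k j)) hβpos le_rfl (hks j)).2,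
    fun j => mul_pos (hc (k j)) hR, ?_, fun y => ?_⟩
  · have h := ((hc0.comp hφt).comp (tendsto_add_atTop_nat j₀)).mul_const R
    rw [zero_mul] at h
    exact h.congr fun j => rfl
  · have key : ∀ j, ((c (k j) * R) ^ 2 / ν) • curl (u (T + c (k j) ^ 2 * β * s))
        (xk (k j) + (c (k j) * R) • y) = curl (w (k j) s) y := fun j => by
      rw [hwdef, curl_smul_stPull]
      congr 1
      rw [hα]
      field_simp
    simp_rw [key]
    have hD : Tendsto (fun j => fderiv ℝ (w (k j) s) y) atTop (𝓝 (fderiv ℝ (W s) y)) :=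
      (hptD s hs y).comp (tendsto_add_atTop_nat j₀)
    show Tendsto (fun j => curlCLM (fderiv ℝ (w (k j) s) y)) atTop (𝓝 (curlCLM (fderiv ℝ (W s) y)))
    exact (curlCLM.continuous.tendsto _).comp hD

end Zoom

end Summit.NavierStokesRegularity.NavierStokesRegularity.Theorems

end
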